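import Literature.Combinatorics.Optimization.PsdFactorizationRescaling
import Literature.Combinatorics.Optimization.SDPFormulationMatchingSlack
import Literature.Combinatorics.Optimization.EquivariantPsdFactorization
import Literature.Barriers.PneNP.TSPExtensionComplexityRothvossTransport
import Literature.Barriers.PneNP.TSPExtensionComplexityPMPolytope
import Literature.Combinatorics.Optimization.BlockPsdLiftFactorization
import HarnessLib

/-!
# Block psd factorizations (`(S^b_+)^m`-lifts) of the perfect-matching slack matrix, and the
# operator-norm form of the (weak) Briët–Dadush–Pokutta rescaling

Two things, both PROVED (no facts asserted):

1. **Rescaling to operator-norm-bounded factors.** Briët–Dadush–Pokutta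
   [cite: BrietDadushPokutta2014, Thm. 6 (§3, p. 7)]: "Let `Δ > 0`, `I, J` finite sets, `M ∈ [0, Δ]^{I×J}`
   with a rank-`r` semidefinite factorization `(U_i)_{i∈I}`, `(V^j)_{j∈J}`. Then there exists `A ⪰ 0` such
   that `(A U_i A)_i`, `(A⁺ V^j A⁺)_j` is a semidefinite factorization of `M` with `max_i ‖A U_i A‖ ≤ √(rΔ)`,
   `max_j ‖A⁺ V^j A⁺‖ ≤ √(rΔ)`" (printed proof via John's ellipsoid theorem, BDP Thm. 5; restated as
   Fawzi–Gouveia–Parrilo–Robinson–Thomas [cite: FawziEtAl2015, Cor. 6.8 (§6.2)]). The tree PROVES the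
   weak elementary form `HasPsdFactorization.rescale_weak` (`M = r²Δ·Tr(X Y)`, `0 ⪯ X, Y ⪯ I`; Auerbach basis,
   no ellipsoids). Here we restate that theorem in the OPERATOR-BOUND ("quadratic form") currency consumed
   by hyperplane/ε-net arguments: same pairings, all factors psd with `vᵀ U' v ≤ r√Δ·|v|²` — i.e. the printed
   statement with `r√Δ` in place of `√(rΔ)` (`exists_rescale_opBound`; and as a closed `Prop` with its
   discharge, `BrietDadushPokutta2014_rescaleWeak` / `_holds`, in the binder shape cell pnp-psdrank typed for
   its route item). NOT here: the sharp `√(rΔ)` (John's theorem is not in Mathlib); for every consumer in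
   which the bound enters polynomially (fixed block size `b`, Rothvoß-type accounting) the weak form suffices.
2. **Block psd factorizations.** Fawzi–Parrilo [cite: FawziParrilo2013, §1.2 (p. 4)]: "Given two integers
   `d` and `r`, we say that a polytope `P` has a `(S^d_+)^r`-lift if `P` is the projection of a feasible set
   of an SDP over `(S^d_+)^r`"; by the Gouveia–Parrilo–Thomas cone-factorization theorem
   [cite: GouveiaParriloThomas2013, Def. 2.2, Thm. 2.4 (§2)] this is a factorization of the slack matrix through the
   (self-dual) cone `(S^d_+)^r`, i.e. "each term nonnegative and of psd-rank `≤ d`"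
   [cite: FawziParrilo2013, §1.2 (p. 5, "Strategy of proof")]; `d = 1` is a nonnegative factorization
   (LP lifts), and `(S^d_+)^r ⊆ S^{dr}_+` [cite: FawziParrilo2013, §1.1 (p. 3)]. We define
   `HasBlockPsdFactorization n b m` — the odd-cut slack matrix `|δ(U) ∩ M| − 1` of Edmonds' perfect matching
   polytope of `K_n` [cite: Rothvoss2017, §2 (PDF p. 5)] has a psd factorization with `m` blocks of size `b`
   (VERBATIM the vocabulary typed by cell pnp-psdrank, planner p2, `leaf-R4/MatchingSmallBlockPsdBound.lean`,
   for the rung target "`(S²₊)^m`-lifts (= second-order-cone lifts) of `P_PM(n)` have `m ≥ 2^{Ω(n)}`") — and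
   prove its basic API: the `OddSet n × PMatch n`-indexed form over the Rothvoß files' slack matrix
   `pmOddCutSlack` (`hasBlockPsdFactorization_iff`), the embedding into ordinary psd factorizations of size
   `b·m` (`HasBlockPsdFactorization.hasPsdFactorization_pmOddCutSlack`), one block of size `d` = a psd
   factorization of size `d` (`hasBlockPsdFactorization_one_iff`), and the BLOCKWISE RESCALING
   (`HasBlockPsdFactorization.exists_rescaled`, `.exists_rescaled_sq`): every block factorization can be
   replaced by one with the same block pairings-sum and all block factors `⪯ b√Δ·I` (`Δ` any bound on the
   slacks, e.g. `Δ = n²`), which is step (1) of the cell's accounting argument.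
3. **Spectral splitting** (§3): a real psd matrix with `vᵀAv ≤ L|v|²` is `Σ_s a_s a_sᵀ` with `|a_s|² ≤ L`
   (`exists_sum_vecMulVec_of_posSemidef`, spectral theorem [cite: BlekhermanParriloThomas2012, App. A Prop. A.1;
   §9.2.1]); hence a block psd factorization yields the RANK-ONE-VECTOR SPLIT
   `|δ(U) ∩ M| − 1 = Σ_i Σ_{s,t} (a_{M,i,s}·c_{U,i,t})²` with `|a|², |c|² ≤ b√Δ` and `a ⊥ c` on the tight pairs
   (`HasBlockPsdFactorization.exists_vectorSplit`, `.exists_vectorSplit_sq`) — steps (1)+(2) of the accounting.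
4. **Faces** (§4): `P_PM(n')` is a face of `P_PM(n)` (`n' ≤ n`, `n − n'` even) and cone factorizations restrict to
   submatrices [cite: GouveiaParriloThomas2013, Thm. 2.4], so `HasBlockPsdFactorization n b m → HasBlockPsdFactorization n' b m`
   (`HasBlockPsdFactorization.of_le`; lets a bound proved at special sizes `n` descend to all smaller even `n'`), and the
   slack of a `t`-set is `≤ t − 1` (`pmOddCutSlack_le_card_sub_one`, the `Δ` to feed `exists_vectorSplit` on `t`-cuts).
5. **The split on the `t`-cut rows** (§5, `HasBlockPsdFactorization.exists_vectorSplit_card`): the same split restricted to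
   the rows `{U // |U| = t}` (`t` odd) with `Δ = t − 1` and the slack spelled `|{f ∈ M : cutCount U f = 1}| − 1`, i.e. in the
   exact index/entry currency of the Rothvoß weight datum `exists_W_slot` / `exists_weights_transport`.

6. **Lifts ⇒ block factorizations** (§6, `hasBlockPsdFactorization_of_hasBlockPsdLift`, appended 2026-08-28): an
   `(S^b_+)^m`-LIFT of the perfect matching polytope `pmPolytope n` (`HasBlockPsdLift`, [cite: FawziParrilo2013, §1 (p. 2)])
   yields `HasBlockPsdFactorization n b m` — the Gouveia–Parrilo–Thomas / Fawzi–Parrilo direction "lift ⇒ factorization"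
   [cite: FawziParrilo2013, Thm. 2 (§2.1, p. 6)] proved Slater-free in `BlockPsdLiftFactorization.lean`
   (`HasBlockPsdLift.hasPsdPowerFactorization_slack`), applied to the points `χ^M` and the odd-set inequalities; so every
   lower bound on `m` proved in the factorization currency of this file is a lower bound on `(S^b_+)^m`-lifts of `P_PM(n)`.

WHAT THIS IS NOT: no lower bound is proved here; nothing about general psd rank beyond the embedding.
-/

noncomputable section

open Matrix Finset
open scoped MatrixOrder

namespace Literature.Combinatorics.Optimization

open Literature.Barriers.PneNP
open Literature.Computation.Certificates.SemidefiniteComplementarity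

/-! ### §1. Rescaling a psd factorization to operator-norm-bounded factors (weak BDP, quadratic-form currency) -/

section OpBound

/-- `X ⪯ I` in quadratic-form currency: `vᵀ X v ≤ |v|²`. [folklore] -/
private theorem form_le_self_of_one_sub {d : Type*} [Fintype d] [DecidableEq d] {X : Matrix d d ℝ}
    (h : (1 - X).PosSemidef) (v : d → ℝ) : v ⬝ᵥ (X *ᵥ v) ≤ v ⬝ᵥ v := by
  have h0 := h.dotProduct_mulVec_nonneg v
  simp only [star_trivial, sub_mulVec, one_mulVec, dotProduct_sub] at h0
  linarith

variable {α β : Type*} [Fintype α] [Fintype β]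

/-- **Briët–Dadush–Pokutta rescaling, operator-bound form (weak constant).** Psd families `U_x, V_y`
(`r × r`) with pairings `Tr(U_x V_y) ≤ Δ` (`0 ≤ Δ`) can be replaced by psd families `U'_x, V'_y` with the
SAME pairings and `vᵀ U'_x v ≤ r√Δ·|v|²`, `vᵀ V'_y v ≤ r√Δ·|v|²` for all `v` (printed: `√(rΔ)` on both
sides, via John's theorem; this is the tree's elementary `rescale_weak` rescaled by `r√Δ`).
[cite: BrietDadushPokutta2014, Thm. 6 (§3, p. 7)] [cite: FawziEtAl2015, Cor. 6.8 (§6.2)] -/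
theorem exists_rescale_opBound (r : ℕ) {Δ : ℝ} (hΔ : 0 ≤ Δ)
    (U : α → Matrix (Fin r) (Fin r) ℝ) (V : β → Matrix (Fin r) (Fin r) ℝ)
    (hU : ∀ x, (U x).PosSemidef) (hV : ∀ y, (V y).PosSemidef)
    (hUV : ∀ x y, (U x * V y).trace ≤ Δ) :
    ∃ (U' : α → Matrix (Fin r) (Fin r) ℝ) (V' : β → Matrix (Fin r) (Fin r) ℝ),
      (∀ x, (U' x).PosSemidef) ∧ (∀ y, (V' y).PosSemidef) ∧
      (∀ x y, (U' x * V' y).trace = (U x * V y).trace) ∧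
      (∀ x (v : Fin r → ℝ), v ⬝ᵥ (U' x *ᵥ v) ≤ r * Real.sqrt Δ * (v ⬝ᵥ v)) ∧
      (∀ y (v : Fin r → ℝ), v ⬝ᵥ (V' y *ᵥ v) ≤ r * Real.sqrt Δ * (v ⬝ᵥ v)) := by
  classical
  rcases hΔ.eq_or_lt with hΔ0 | hΔpos
  · -- `Δ = 0`: every pairing vanishes; zero factors do the job
    refine ⟨fun _ => 0, fun _ => 0, fun _ => PosSemidef.zero, fun _ => PosSemidef.zero,
      fun x y => ?_, fun x v => ?_, fun y v => ?_⟩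
    · have h0 : 0 ≤ (U x * V y).trace := frob_nonneg_of_posSemidef (hU x) (hV y)
      have h1 : (U x * V y).trace ≤ 0 := hΔ0 ▸ hUV x y
      rw [Matrix.zero_mul, trace_zero]
      linarith
    · simp [← hΔ0]
    · simp [← hΔ0]
  -- `Δ > 0`: the weak rescaling of `M x y := Tr(U_x V_y)`, then scale both sides by `r√Δ`
  have hfac : HasPsdFactorization (fun x y => (U x * V y).trace) r := ⟨U, V, hU, hV, fun _ _ => rfl⟩
  obtain ⟨X, Y, hX, hY, hMXY⟩ := hfac.rescale_weak hΔpos hUV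
  set c : ℝ := r * Real.sqrt Δ with hc
  have hc0 : 0 ≤ c := by positivity
  have hcc : c * c = (r : ℝ) ^ 2 * Δ := by
    rw [hc, mul_mul_mul_comm, Real.mul_self_sqrt hΔ, sq]
  refine ⟨fun x => c • X x, fun y => c • Y y, fun x => (hX x).1.smul hc0, fun y => (hY y).1.smul hc0,
    fun x y => ?_, fun x v => ?_, fun y v => ?_⟩
  · rw [Matrix.smul_mul, Matrix.mul_smul, trace_smul, trace_smul, smul_eq_mul, smul_eq_mul, ← mul_assoc,
      hcc]
    exact (hMXY x y).symm
  · rw [smul_mulVec, dotProduct_smul, smul_eq_mul]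
    exact mul_le_mul_of_nonneg_left (form_le_self_of_one_sub (hX x).2 v) hc0
  · rw [smul_mulVec, dotProduct_smul, smul_eq_mul]
    exact mul_le_mul_of_nonneg_left (form_le_self_of_one_sub (hY y).2 v) hc0

end OpBound

/-- **The weak Briët–Dadush–Pokutta rescaling as a closed statement** (binder shape typed by cell
pnp-psdrank for its route item `BDPRescale`, `Sketch-R4-smallblock.lean`; constant `r√Δ` where the printed
theorem — John's ellipsoid — has `√(rΔ)`): for every finite psd families `U_x, V_y ∈ S^r_+` with pairings in
`[0, Δ]` there are psd families with the same pairings and quadratic forms bounded by `r√Δ·|v|²`. PROVED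
below (`BrietDadushPokutta2014_rescaleWeak_holds`). [cite: BrietDadushPokutta2014, Thm. 6 (§3, p. 7)] -/
def BrietDadushPokutta2014_rescaleWeak : Prop :=
  ∀ (r : ℕ) (α β : Type) [Fintype α] [Fintype β] (Δ : ℝ)
    (U : α → Matrix (Fin r) (Fin r) ℝ) (V : β → Matrix (Fin r) (Fin r) ℝ),
    0 ≤ Δ → (∀ x, (U x).PosSemidef) → (∀ y, (V y).PosSemidef) →
    (∀ x y, 0 ≤ (U x * V y).trace ∧ (U x * V y).trace ≤ Δ) →
    ∃ (U' : α → Matrix (Fin r) (Fin r) ℝ) (V' : β → Matrix (Fin r) (Fin r) ℝ),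
      (∀ x, (U' x).PosSemidef) ∧ (∀ y, (V' y).PosSemidef) ∧
      (∀ x y, (U' x * V' y).trace = (U x * V y).trace) ∧
      (∀ x (v : Fin r → ℝ), dotProduct v ((U' x).mulVec v) ≤ r * Real.sqrt Δ * dotProduct v v) ∧
      (∀ y (v : Fin r → ℝ), dotProduct v ((V' y).mulVec v) ≤ r * Real.sqrt Δ * dotProduct v v)

/-- DISCHARGE of `BrietDadushPokutta2014_rescaleWeak` (from `exists_rescale_opBound`).
[cite: BrietDadushPokutta2014, Thm. 6 (§3, p. 7)] -/
theorem BrietDadushPokutta2014_rescaleWeak_holds : BrietDadushPokutta2014_rescaleWeak := by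
  intro r α β _ _ Δ U V hΔ hU hV hUV
  exact exists_rescale_opBound r hΔ U V hU hV fun x y => (hUV x y).2

/-! ### §2. Block psd factorizations of the odd-cut slack matrix of the perfect matching polytope -/

section Block

variable {n : ℕ}

/-- The odd-cut slack matrix of `P_PM(n)` has a **psd factorization with `m` blocks of size `b`**:
psd `b × b` matrices `A M i` (perfect matchings `M`) and `B U i` (odd sets `U`) with
`|δ(U) ∩ M| − 1 = Σ_i tr(A M i · B U i)`. Equivalently `P_PM(n)` has an `(S^b_+)^m`-lift
(Gouveia–Parrilo–Thomas, cone factorizations); `b = 1` is a nonnegative factorization of size `m`,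
`b = 2` are second-order-cone lifts. Verbatim the cell vocabulary (pnp-psdrank p2, leaf R4).
[cite: FawziParrilo2013, §1.2 (p. 4)] [cite: GouveiaParriloThomas2013, Def. 2.2, Thm. 2.4 (§2)] -/
def HasBlockPsdFactorization (n b m : ℕ) : Prop :=
  ∃ (A : Finset (Sym2 (Fin n)) → Fin m → Matrix (Fin b) (Fin b) ℝ)
    (B : Finset (Fin n) → Fin m → Matrix (Fin b) (Fin b) ℝ),
    (∀ M i, IsPMOn (univ : Finset (Fin n)) M → (A M i).PosSemidef) ∧
    (∀ U i, Odd U.card → (B U i).PosSemidef) ∧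
    ∀ U M, Odd U.card → IsPMOn (univ : Finset (Fin n)) M →
      pmSlack U M = ∑ i, (A M i * B U i).trace

/-- The two spellings of the odd-cut slack agree: `pmOddCutSlack n U M = pmSlack U.1 M.1`
(`cc U M − 1 = |{e ∈ M : cutCount U e = 1}| − 1`). [cite: Rothvoss2017, §2 (PDF p. 5)] -/
theorem pmOddCutSlack_eq_pmSlack (U : OddSet n) (M : PMatch n) :
    pmOddCutSlack n U M = pmSlack U.1 M.1 := by
  rw [pmOddCutSlack_apply, cc_eq_card_filter]
  rfl

/-- **Subtype form.** A block psd factorization is the same as psd families indexed by the Rothvoß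
files' row/column types `OddSet n`, `PMatch n` factorizing `pmOddCutSlack n` blockwise (extend by `0`
outside the perfect matchings / odd sets in the converse direction).
[cite: FawziParrilo2013, §1.2 (p. 4)] -/
theorem hasBlockPsdFactorization_iff {b m : ℕ} :
    HasBlockPsdFactorization n b m ↔
      ∃ (A : PMatch n → Fin m → Matrix (Fin b) (Fin b) ℝ)
        (B : OddSet n → Fin m → Matrix (Fin b) (Fin b) ℝ),
        (∀ M i, (A M i).PosSemidef) ∧ (∀ U i, (B U i).PosSemidef) ∧
        ∀ U M, pmOddCutSlack n U M = ∑ i, (A M i * B U i).trace := by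
  classical
  constructor
  · rintro ⟨A, B, hA, hB, hS⟩
    refine ⟨fun M i => A M.1 i, fun U i => B U.1 i, fun M i => hA M.1 i M.2, fun U i => hB U.1 i U.2,
      fun U M => ?_⟩
    rw [pmOddCutSlack_eq_pmSlack]
    exact hS U.1 M.1 U.2 M.2
  · rintro ⟨A, B, hA, hB, hS⟩
    refine ⟨fun M i => if h : IsPMOn univ M then A ⟨M, h⟩ i else 0,
      fun U i => if h : Odd U.card then B ⟨U, h⟩ i else 0, fun M i hM => ?_, fun U i hU => ?_,
      fun U M hU hM => ?_⟩
    · simp only [dif_pos hM]; exact hA _ i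
    · simp only [dif_pos hU]; exact hB _ i
    · have := hS ⟨U, hU⟩ ⟨M, hM⟩
      rw [pmOddCutSlack_eq_pmSlack] at this
      simpa only [dif_pos hM, dif_pos hU] using this

/-- Trace is invariant under simultaneous reindexing of rows and columns by an equivalence. [folklore] -/
private theorem trace_submatrix_equiv {p q : Type*} [Fintype p] [Fintype q] (X : Matrix q q ℝ) (e : p ≃ q) :
    (X.submatrix e e).trace = X.trace := by
  simp only [Matrix.trace, Matrix.diag, submatrix_apply]
  exact Fintype.sum_equiv e _ _ fun _ => rfl

/-- A block-diagonal matrix with psd blocks is psd (over `ℝ`; Gram form `A_k = C_kᴴ C_k` blockwise).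
[cite: FawziParrilo2013, §1.1 (p. 3)] -/
private theorem posSemidef_blockDiagonal_of {o d : Type*} [Fintype o] [DecidableEq o] [Fintype d]
    [DecidableEq d] {A : o → Matrix d d ℝ} (h : ∀ k, (A k).PosSemidef) :
    (blockDiagonal A).PosSemidef := by
  choose C hC using fun k => exists_eq_conjTranspose_mul_self (h k)
  have hblk : blockDiagonal A = (blockDiagonal C)ᴴ * blockDiagonal C := by
    rw [blockDiagonal_conjTranspose, ← blockDiagonal_mul]
    congr 1
    funext k
    exact hC k
  rw [hblk]
  exact posSemidef_conjTranspose_mul_self _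

/-- **`(S^b_+)^m ⊆ S^{bm}_+`**: a block psd factorization with `m` blocks of size `b` is an ordinary psd
factorization of size `b·m` of the odd-cut slack matrix (block-diagonal embedding), so every psd-rank
lower bound for `pmOddCutSlack n` bounds `b·m`. [cite: FawziParrilo2013, §1.1 (p. 3)] -/
theorem HasBlockPsdFactorization.hasPsdFactorization_pmOddCutSlack {b m : ℕ}
    (h : HasBlockPsdFactorization n b m) : HasPsdFactorization (pmOddCutSlack n) (b * m) := by
  classical
  obtain ⟨A, B, hA, hB, hS⟩ := hasBlockPsdFactorization_iff.1 h
  let e : Fin (b * m) ≃ Fin b × Fin m := finProdFinEquiv.symm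
  -- rows of `pmOddCutSlack n` are the odd sets, columns the perfect matchings
  refine ⟨fun U => (blockDiagonal (B U)).submatrix e e, fun M => (blockDiagonal (A M)).submatrix e e,
    fun U => (posSemidef_blockDiagonal_of (hB U)).submatrix e,
    fun M => (posSemidef_blockDiagonal_of (hA M)).submatrix e, fun U M => ?_⟩
  rw [submatrix_mul_equiv, trace_submatrix_equiv, ← blockDiagonal_mul, trace_blockDiagonal, hS U M]
  exact sum_congr rfl fun i _ => Matrix.trace_mul_comm _ _

/-- **One block of size `d` is a psd factorization of size `d`** (and conversely): the case `m = 1`.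
[cite: GouveiaParriloThomas2013, Def. 2.2, Thm. 2.4 (§2)] -/
theorem hasBlockPsdFactorization_one_iff {d : ℕ} :
    HasBlockPsdFactorization n d 1 ↔ HasPsdFactorization (pmOddCutSlack n) d := by
  rw [hasBlockPsdFactorization_iff]
  constructor
  · rintro ⟨A, B, hA, hB, hS⟩
    -- row index of `HasPsdFactorization (pmOddCutSlack n)` is `OddSet n`, column index `PMatch n`
    refine ⟨fun U => B U 0, fun M => A M 0, fun U => hB U 0, fun M => hA M 0, fun U M => ?_⟩
    rw [hS U M, Fin.sum_univ_one, Matrix.trace_mul_comm]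
  · rintro ⟨X, Y, hX, hY, hS⟩
    refine ⟨fun M _ => Y M, fun U _ => X U, fun M _ => hY M, fun U _ => hX U, fun U M => ?_⟩
    rw [Fin.sum_univ_one, Matrix.trace_mul_comm]
    exact hS U M

/-- Each block pairing is dominated by the total: `Tr(A M i · B U i) ≤ Σ_j Tr(A M j · B U j)`
(all terms are pairings of psd matrices, hence `≥ 0`). [folklore] -/
private theorem trace_block_le_sum {b m : ℕ} {A : PMatch n → Fin m → Matrix (Fin b) (Fin b) ℝ}
    {B : OddSet n → Fin m → Matrix (Fin b) (Fin b) ℝ} (hA : ∀ M i, (A M i).PosSemidef)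
    (hB : ∀ U i, (B U i).PosSemidef) (U : OddSet n) (M : PMatch n) (i : Fin m) :
    (A M i * B U i).trace ≤ ∑ j, (A M j * B U j).trace :=
  single_le_sum (f := fun j => (A M j * B U j).trace)
    (fun j _ => frob_nonneg_of_posSemidef (hA M j) (hB U j)) (mem_univ i)

/-- **Blockwise rescaling** (step (1) of the cell's accounting): if the slacks are `≤ Δ` (`0 ≤ Δ`), a block
psd factorization with `m` blocks of size `b` can be replaced by one (same `b`, `m`, same slack identity on
`OddSet n × PMatch n`) all of whose block factors satisfy `vᵀ A v ≤ b√Δ·|v|²`, `vᵀ B v ≤ b√Δ·|v|²` —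
each block is rescaled separately by `exists_rescale_opBound` (its pairings are `≤` the slack `≤ Δ`).
[cite: BrietDadushPokutta2014, Thm. 6 (§3, p. 7)] -/
theorem HasBlockPsdFactorization.exists_rescaled {b m : ℕ} (h : HasBlockPsdFactorization n b m)
    {Δ : ℝ} (hΔ : 0 ≤ Δ) (hSΔ : ∀ (U : OddSet n) (M : PMatch n), pmOddCutSlack n U M ≤ Δ) :
    ∃ (A : PMatch n → Fin m → Matrix (Fin b) (Fin b) ℝ)
      (B : OddSet n → Fin m → Matrix (Fin b) (Fin b) ℝ),
      (∀ M i, (A M i).PosSemidef) ∧ (∀ U i, (B U i).PosSemidef) ∧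
      (∀ U M, pmOddCutSlack n U M = ∑ i, (A M i * B U i).trace) ∧
      (∀ M i (v : Fin b → ℝ), v ⬝ᵥ (A M i *ᵥ v) ≤ b * Real.sqrt Δ * (v ⬝ᵥ v)) ∧
      (∀ U i (v : Fin b → ℝ), v ⬝ᵥ (B U i *ᵥ v) ≤ b * Real.sqrt Δ * (v ⬝ᵥ v)) := by
  classical
  obtain ⟨A, B, hA, hB, hS⟩ := hasBlockPsdFactorization_iff.1 h
  have hblock : ∀ i : Fin m, ∀ (M : PMatch n) (U : OddSet n), (A M i * B U i).trace ≤ Δ := by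
    intro i M U
    calc (A M i * B U i).trace ≤ ∑ j, (A M j * B U j).trace := trace_block_le_sum hA hB U M i
      _ = pmOddCutSlack n U M := (hS U M).symm
      _ ≤ Δ := hSΔ U M
  have hresc := fun i : Fin m =>
    exists_rescale_opBound b hΔ (fun M : PMatch n => A M i) (fun U : OddSet n => B U i)
      (fun M => hA M i) (fun U => hB U i) (fun M U => hblock i M U)
  choose A' B' hA' hB' htr hA'le hB'le using hresc
  refine ⟨fun M i => A' i M, fun U i => B' i U, fun M i => hA' i M, fun U i => hB' i U, fun U M => ?_,
    fun M i v => hA'le i M v, fun U i v => hB'le i U v⟩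
  rw [hS U M]
  exact sum_congr rfl fun i _ => (htr i M U).symm

/-- The blockwise rescaling with the crude slack bound `|δ(U) ∩ M| − 1 ≤ n²` (`cc_sub_one_le`): all
block factors `⪯ b·n·I` in quadratic-form currency. [cite: BrietDadushPokutta2014, Thm. 6 (§3, p. 7)] -/
theorem HasBlockPsdFactorization.exists_rescaled_sq {b m : ℕ} (h : HasBlockPsdFactorization n b m) :
    ∃ (A : PMatch n → Fin m → Matrix (Fin b) (Fin b) ℝ)
      (B : OddSet n → Fin m → Matrix (Fin b) (Fin b) ℝ),
      (∀ M i, (A M i).PosSemidef) ∧ (∀ U i, (B U i).PosSemidef) ∧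
      (∀ U M, pmOddCutSlack n U M = ∑ i, (A M i * B U i).trace) ∧
      (∀ M i (v : Fin b → ℝ), v ⬝ᵥ (A M i *ᵥ v) ≤ b * n * (v ⬝ᵥ v)) ∧
      (∀ U i (v : Fin b → ℝ), v ⬝ᵥ (B U i *ᵥ v) ≤ b * n * (v ⬝ᵥ v)) := by
  have hsq : Real.sqrt ((n : ℝ) ^ 2) = n := Real.sqrt_sq (Nat.cast_nonneg n)
  obtain ⟨A, B, hA, hB, hS, hAle, hBle⟩ :=
    h.exists_rescaled (Δ := (n : ℝ) ^ 2) (by positivity) fun U M => by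
      rw [pmOddCutSlack_apply]; exact cc_sub_one_le U M
  refine ⟨A, B, hA, hB, hS, fun M i v => ?_, fun U i v => ?_⟩
  · simpa only [hsq] using hAle M i v
  · simpa only [hsq] using hBle U i v

end Block

/-! ### §3. Spectral splitting: block factors as sums of rank-one terms (steps (1)+(2) of the accounting) -/

section Split

/-- **Spectral splitting of a bounded psd matrix into rank-one terms.** A real psd matrix `A` with
`vᵀ A v ≤ L·|v|²` for all `v` is a sum `A = Σ_s a_s a_sᵀ` (one term per index, `a_s = √λ_s · u_s` for
an orthonormal eigenbasis `u_s`) with `|a_s|² = λ_s ≤ L` (eigenvalues of a psd matrix are `≥ 0`; the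
Rayleigh quotient bounds them by `L`). [cite: BlekhermanParriloThomas2012, App. A Prop. A.1 (3),(6); §9.2.1 (p. 396–397)] -/
theorem exists_sum_vecMulVec_of_posSemidef {d : Type*} [Fintype d] [DecidableEq d]
    {A : Matrix d d ℝ} (hA : A.PosSemidef) {L : ℝ} (hL : ∀ v : d → ℝ, v ⬝ᵥ (A *ᵥ v) ≤ L * (v ⬝ᵥ v)) :
    ∃ a : d → d → ℝ, (A = ∑ s, vecMulVec (a s) (a s)) ∧ ∀ s, a s ⬝ᵥ a s ≤ L := by
  have hH : A.IsHermitian := hA.1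
  set U : Matrix d d ℝ := (hH.eigenvectorUnitary : Matrix d d ℝ) with hUdef
  set lam : d → ℝ := hH.eigenvalues with hlam
  -- the spectral theorem in real form: `A = U · diag(λ) · Uᵀ`
  have hspec : A = U * diagonal lam * Uᵀ := by
    have h := hH.spectral_theorem
    rw [Unitary.conjStarAlgAut_apply, star_eq_conjTranspose, conjTranspose_eq_transpose_of_trivial] at h
    have hid : (RCLike.ofReal ∘ hH.eigenvalues : d → ℝ) = lam := by
      funext j
      simp [hlam]
    rw [hid] at h
    exact h
  have hentry : ∀ i k, A i k = ∑ j, U i j * lam j * U k j := by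
    intro i k
    rw [hspec, Matrix.mul_apply]
    refine sum_congr rfl fun j _ => ?_
    rw [mul_diagonal, transpose_apply]
  -- columns are orthonormal: `Uᵀ U = 1`
  have hunit : Uᵀ * U = 1 := by
    have h := Unitary.coe_star_mul_self hH.eigenvectorUnitary
    rwa [star_eq_conjTranspose, conjTranspose_eq_transpose_of_trivial] at h
  have hcol : ∀ j, (fun i => U i j) ⬝ᵥ (fun i => U i j) = 1 := by
    intro j
    have h := congrFun (congrFun hunit j) j
    rw [Matrix.mul_apply, one_apply_eq] at h
    simpa only [transpose_apply, dotProduct] using h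
  -- columns are eigenvectors: `A u_j = λ_j u_j`, hence `λ_j ≤ L`; and `λ_j ≥ 0`
  have hcolfun : ∀ j, (⇑(hH.eigenvectorBasis j) : d → ℝ) = fun i => U i j := by
    intro j
    funext i
    exact (Matrix.IsHermitian.eigenvectorUnitary_apply hH i j).symm
  have heig : ∀ j, A *ᵥ (fun i => U i j) = lam j • (fun i => U i j) := by
    intro j
    have h := hH.mulVec_eigenvectorBasis j
    rwa [hcolfun j] at h
  have hlamL : ∀ j, lam j ≤ L := by
    intro j
    have h1 := hL (fun i => U i j)
    rw [heig j, dotProduct_smul, smul_eq_mul, hcol j, mul_one, mul_one] at h1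
    exact h1
  have hlam0 : ∀ j, 0 ≤ lam j := fun j => hA.eigenvalues_nonneg j
  refine ⟨fun j i => Real.sqrt (lam j) * U i j, ?_, fun j => ?_⟩
  · ext i k
    rw [hentry i k, Matrix.sum_apply]
    refine sum_congr rfl fun j _ => ?_
    rw [vecMulVec_apply]
    have hs := Real.mul_self_sqrt (hlam0 j)
    calc U i j * lam j * U k j = Real.sqrt (lam j) * Real.sqrt (lam j) * (U i j * U k j) := by rw [hs]; ring
      _ = Real.sqrt (lam j) * U i j * (Real.sqrt (lam j) * U k j) := by ring
  · have hsq : (fun i => Real.sqrt (lam j) * U i j) ⬝ᵥ (fun i => Real.sqrt (lam j) * U i j) =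
        lam j * ((fun i => U i j) ⬝ᵥ (fun i => U i j)) := by
      simp only [dotProduct]
      rw [Finset.mul_sum]
      refine sum_congr rfl fun i _ => ?_
      have hs := Real.mul_self_sqrt (hlam0 j)
      calc Real.sqrt (lam j) * U i j * (Real.sqrt (lam j) * U i j)
          = Real.sqrt (lam j) * Real.sqrt (lam j) * (U i j * U i j) := by ring
        _ = lam j * (U i j * U i j) := by rw [hs]
    rw [hsq, hcol j, mul_one]
    exact hlamL j

/-- `Tr(a aᵀ · c cᵀ) = (a·c)²`. [folklore] -/
private theorem trace_vecMulVec_mul_vecMulVec {d : Type*} [Fintype d] (a c : d → ℝ) :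
    (vecMulVec a a * vecMulVec c c).trace = (a ⬝ᵥ c) ^ 2 := by
  rw [vecMulVec_mul_vecMulVec, trace_vecMulVec, dotProduct_smul, smul_eq_mul, sq]

variable {n : ℕ}

/-- **Rank-one-vector split of a block psd factorization** (steps (1)+(2) of the cell's accounting
argument in one statement): if the slacks are `≤ Δ` (`0 ≤ Δ`), a block psd factorization with `m` blocks
of size `b` yields vectors `a_{M,i,s}, c_{U,i,t} ∈ ℝ^b` (`i < m`, `s, t < b`) with
`|δ(U) ∩ M| − 1 = Σ_i Σ_{s,t} (a_{M,i,s} · c_{U,i,t})²`, all `|a|², |c|² ≤ b√Δ`, and — since every term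
is a square — `a_{M,i,s} ⊥ c_{U,i,t}` on the TIGHT pairs (`|δ(U) ∩ M| = 1`). Rescaling
[cite: BrietDadushPokutta2014, Thm. 6 (§3, p. 7)] followed by the spectral decomposition of each block
[cite: BlekhermanParriloThomas2012, App. A Prop. A.1 (3),(6)]. -/
theorem HasBlockPsdFactorization.exists_vectorSplit {b m : ℕ} (h : HasBlockPsdFactorization n b m)
    {Δ : ℝ} (hΔ : 0 ≤ Δ) (hSΔ : ∀ (U : OddSet n) (M : PMatch n), pmOddCutSlack n U M ≤ Δ) :
    ∃ (a : PMatch n → Fin m → Fin b → Fin b → ℝ) (c : OddSet n → Fin m → Fin b → Fin b → ℝ),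
      (∀ U M, pmOddCutSlack n U M = ∑ i, ∑ s, ∑ t, (a M i s ⬝ᵥ c U i t) ^ 2) ∧
      (∀ M i s, a M i s ⬝ᵥ a M i s ≤ b * Real.sqrt Δ) ∧
      (∀ U i t, c U i t ⬝ᵥ c U i t ≤ b * Real.sqrt Δ) ∧
      (∀ U M, pmOddCutSlack n U M = 0 → ∀ i s t, a M i s ⬝ᵥ c U i t = 0) := by
  classical
  obtain ⟨A, B, hA, hB, hS, hAle, hBle⟩ := h.exists_rescaled hΔ hSΔ
  have hsplitA := fun (M : PMatch n) (i : Fin m) =>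
    exists_sum_vecMulVec_of_posSemidef (hA M i) (hAle M i)
  have hsplitB := fun (U : OddSet n) (i : Fin m) =>
    exists_sum_vecMulVec_of_posSemidef (hB U i) (hBle U i)
  choose a haeq hale using hsplitA
  choose c hceq hcle using hsplitB
  have hid : ∀ U M, pmOddCutSlack n U M = ∑ i, ∑ s, ∑ t, (a M i s ⬝ᵥ c U i t) ^ 2 := by
    intro U M
    rw [hS U M]
    refine sum_congr rfl fun i _ => ?_
    rw [haeq M i, hceq U i, Finset.sum_mul, trace_sum]
    refine sum_congr rfl fun s _ => ?_
    rw [Finset.mul_sum, trace_sum]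
    exact sum_congr rfl fun t _ => trace_vecMulVec_mul_vecMulVec _ _
  refine ⟨a, c, hid, fun M i s => hale M i s, fun U i t => hcle U i t, fun U M h0 i s t => ?_⟩
  -- a vanishing sum of squares has vanishing terms
  rw [hid U M] at h0
  have h1 : ∑ s, ∑ t, (a M i s ⬝ᵥ c U i t) ^ 2 = 0 :=
    (sum_eq_zero_iff_of_nonneg fun i _ => sum_nonneg fun s _ => sum_nonneg fun t _ => sq_nonneg _).1
      h0 i (mem_univ i)
  have h2 : ∑ t, (a M i s ⬝ᵥ c U i t) ^ 2 = 0 :=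
    (sum_eq_zero_iff_of_nonneg fun s _ => sum_nonneg fun t _ => sq_nonneg _).1 h1 s (mem_univ s)
  have h3 : (a M i s ⬝ᵥ c U i t) ^ 2 = 0 :=
    (sum_eq_zero_iff_of_nonneg fun t _ => sq_nonneg _).1 h2 t (mem_univ t)
  exact pow_eq_zero_iff (two_ne_zero) |>.1 h3

/-- The rank-one-vector split with the crude slack bound `Δ = n²`: all `|a|², |c|² ≤ b·n`.
[cite: BrietDadushPokutta2014, Thm. 6 (§3, p. 7)] -/
theorem HasBlockPsdFactorization.exists_vectorSplit_sq {b m : ℕ} (h : HasBlockPsdFactorization n b m) :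
    ∃ (a : PMatch n → Fin m → Fin b → Fin b → ℝ) (c : OddSet n → Fin m → Fin b → Fin b → ℝ),
      (∀ U M, pmOddCutSlack n U M = ∑ i, ∑ s, ∑ t, (a M i s ⬝ᵥ c U i t) ^ 2) ∧
      (∀ M i s, a M i s ⬝ᵥ a M i s ≤ b * n) ∧
      (∀ U i t, c U i t ⬝ᵥ c U i t ≤ b * n) ∧
      (∀ U M, pmOddCutSlack n U M = 0 → ∀ i s t, a M i s ⬝ᵥ c U i t = 0) := by
  have hsq : Real.sqrt ((n : ℝ) ^ 2) = n := Real.sqrt_sq (Nat.cast_nonneg n)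
  obtain ⟨a, c, hid, hale, hcle, htight⟩ :=
    h.exists_vectorSplit (Δ := (n : ℝ) ^ 2) (by positivity) fun U M => by
      rw [pmOddCutSlack_apply]; exact cc_sub_one_le U M
  refine ⟨a, c, hid, fun M i s => ?_, fun U i t => ?_, htight⟩
  · simpa only [hsq] using hale M i s
  · simpa only [hsq] using hcle U i t

end Split

/-! ### §4. Faces: block factorizations restrict from `K_n` to `K_{n'}`, `n' ≤ n`, `n - n'` even -/

section Face

/-- The slack of a `t`-set is at most `t − 1`: `|δ(U) ∩ M| ≤ |U|`. [cite: Rothvoss2017, §2 (PDF p. 5)] -/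
theorem pmOddCutSlack_le_card_sub_one {n : ℕ} (U : OddSet n) (M : PMatch n) :
    pmOddCutSlack n U M ≤ (U.1.card : ℝ) - 1 := by
  rw [pmOddCutSlack_apply, cc_eq_card_filter]
  have h := M.2.card_cut_le (subset_univ U.1)
  have : ((M.1.filter fun e => cutCount U.1 e = 1).card : ℝ) ≤ U.1.card := by exact_mod_cast h
  linarith

/-- An edge inside the complement of `U`'s ambient image is not cut by `U`. [folklore] -/
private theorem cutCount_eq_zero_of_subset {V : Type*} [DecidableEq V] {U C : Finset V}
    (hUC : Disjoint U C) {f : Sym2 V} (hf : f ∈ C.sym2) : cutCount U f = 0 := by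
  induction f using Sym2.ind with
  | h a b =>
    rw [Finset.mk_mem_sym2_iff] at hf
    have ha : a ∉ U := fun h => disjoint_left.1 hUC h hf.1
    have hb : b ∉ U := fun h => disjoint_left.1 hUC h hf.2
    simp [cutCount_mk, ha, hb]

/-- **Face monotonicity.** `P_PM(n')` is a face of `P_PM(n)` for `n' ≤ n` with `n − n'` even (fix a
perfect matching `M₀` of the last `n − n'` vertices; `M' ↦ M' ∪ M₀`, `U' ↦ U'`, and
`|δ(U') ∩ (M' ∪ M₀)| = |δ(U') ∩ M'|`), and cone factorizations of a slack matrix restrict to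
submatrices: a block psd factorization for `K_n` yields one for `K_{n'}` with the same `b`, `m`.
[cite: GouveiaParriloThomas2013, Def. 2.2, Thm. 2.4 (§2)] [cite: Rothvoss2017, §1 (PDF p. 4)] -/
theorem HasBlockPsdFactorization.of_le {n n' b m : ℕ} (h : HasBlockPsdFactorization n b m)
    (hle : n' ≤ n) (hev : Even (n - n')) : HasBlockPsdFactorization n' b m := by
  classical
  obtain ⟨A, B, hA, hB, hS⟩ := h
  set e : Fin n' ↪ Fin n := Fin.castLEEmb hle with he
  -- the complement of the image and a perfect matching on it
  set C : Finset (Fin n) := univ \ univ.map e with hC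
  have hCcard : C.card = n - n' := by
    rw [hC, card_sdiff_of_subset (subset_univ _), card_univ, Fintype.card_fin, card_map, card_univ,
      Fintype.card_fin]
  obtain ⟨M₀, hM₀⟩ := exists_isPMOn_of_even (n - n') C hCcard hev
  have hdisj : Disjoint (univ.map e) C := by rw [hC]; exact disjoint_sdiff
  have hcover : univ.map e ∪ C = (univ : Finset (Fin n)) := by
    rw [hC, union_sdiff_of_subset (subset_univ _)]
  -- lifting matchings: `M' ↦ e(M') ∪ M₀`
  have himg : ∀ M' : Finset (Sym2 (Fin n')), IsPMOn univ M' →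
      IsPMOn (univ.map e) (M'.image (Sym2.map e)) := by
    intro M' hM'
    have := hM'.image e (Set.injOn_of_injective e.injective)
    rwa [← Finset.map_eq_image] at this
  have hlift : ∀ M' : Finset (Sym2 (Fin n')), IsPMOn univ M' →
      IsPMOn (univ : Finset (Fin n)) (M'.image (Sym2.map e) ∪ M₀) := by
    intro M' hM'
    rw [← hcover]
    exact (himg M' hM').union hM₀ hdisj
  -- the slack is preserved
  have hslack : ∀ (U' : Finset (Fin n')) (M' : Finset (Sym2 (Fin n'))),
      pmSlack (U'.map e) (M'.image (Sym2.map e) ∪ M₀) = pmSlack U' M' := by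
    intro U' M'
    unfold pmSlack
    have hUC : Disjoint (U'.map e) C :=
      hdisj.mono_left (map_subset_map.2 (subset_univ U'))
    have h0 : (M₀.filter fun f => cutCount (U'.map e) f = 1) = ∅ := by
      refine filter_eq_empty_iff.2 fun f hf => ?_
      rw [cutCount_eq_zero_of_subset hUC (hM₀.subset_sym2 hf)]
      exact zero_ne_one
    rw [filter_union, h0, union_empty, card_cut_image]
  refine ⟨fun M' i => A (M'.image (Sym2.map e) ∪ M₀) i, fun U' i => B (U'.map e) i,
    fun M' i hM' => hA _ i (hlift M' hM'), fun U' i hU' => hB _ i (by rwa [card_map]),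
    fun U' M' hU' hM' => ?_⟩
  rw [← hslack U' M']
  exact hS _ _ (by rwa [card_map]) (hlift M' hM')

end Face

/-! ### §5. The split on the `t`-cut rows, in the currency of Rothvoß's weight datum -/

section TCut

variable {n : ℕ}

/-- **Rank-one-vector split on the `t`-cuts** (`t` odd), with the sharp slack bound `Δ = t − 1` and the
slack spelled exactly as in the Rothvoß weight datum (`exists_W_slot` / `exists_weights_transport`:
rows `{U // |U| = t}`, columns `{M // M perfect matching}`, entry `|{f ∈ M : cutCount U f = 1}| − 1`):
a block psd factorization with `m` blocks of size `b` yields `a_{M,i,s}, c_{U,i,s'} ∈ ℝ^b` with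
`|δ(U) ∩ M| − 1 = Σ_i Σ_{s,s'} (a_{M,i,s}·c_{U,i,s'})²`, `|a|², |c|² ≤ b√(t−1)`, and `a ⊥ c` on tight pairs.
(Rescale the `t`-row submatrix blockwise [cite: BrietDadushPokutta2014, Thm. 6 (§3, p. 7)], then split
spectrally [cite: BlekhermanParriloThomas2012, App. A Prop. A.1 (3),(6)].) -/
theorem HasBlockPsdFactorization.exists_vectorSplit_card {b m t : ℕ} (h : HasBlockPsdFactorization n b m)
    (ht : Odd t) :
    ∃ (a : PMatch n → Fin m → Fin b → Fin b → ℝ)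
      (c : {U : Finset (Fin n) // U.card = t} → Fin m → Fin b → Fin b → ℝ),
      (∀ (U : {U : Finset (Fin n) // U.card = t}) (M : PMatch n),
        (((M.1.filter fun f => cutCount U.1 f = 1).card : ℝ) - 1) =
          ∑ i, ∑ s, ∑ s', (a M i s ⬝ᵥ c U i s') ^ 2) ∧
      (∀ M i s, a M i s ⬝ᵥ a M i s ≤ b * Real.sqrt ((t : ℝ) - 1)) ∧
      (∀ U i s', c U i s' ⬝ᵥ c U i s' ≤ b * Real.sqrt ((t : ℝ) - 1)) ∧
      (∀ (U : {U : Finset (Fin n) // U.card = t}) (M : PMatch n),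
        (M.1.filter fun f => cutCount U.1 f = 1).card = 1 → ∀ i s s', a M i s ⬝ᵥ c U i s' = 0) := by
  classical
  obtain ⟨A, B, hA, hB, hS⟩ := hasBlockPsdFactorization_iff.1 h
  -- the `t`-rows as odd sets
  have hodd : ∀ U : {U : Finset (Fin n) // U.card = t}, Odd U.1.card := fun U => U.2.symm ▸ ht
  set row : {U : Finset (Fin n) // U.card = t} → OddSet n := fun U => ⟨U.1, hodd U⟩ with hrow
  have hslack : ∀ (U : {U : Finset (Fin n) // U.card = t}) (M : PMatch n),
      (((M.1.filter fun f => cutCount U.1 f = 1).card : ℝ) - 1) = pmOddCutSlack n (row U) M := by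
    intro U M
    rw [pmOddCutSlack_apply, cc_eq_card_filter]
  have hΔ : (0 : ℝ) ≤ (t : ℝ) - 1 := by
    obtain ⟨k, hk⟩ := ht
    have : (1 : ℝ) ≤ t := by exact_mod_cast (by omega : 1 ≤ t)
    linarith
  have hSΔ : ∀ (U : {U : Finset (Fin n) // U.card = t}) (M : PMatch n),
      pmOddCutSlack n (row U) M ≤ (t : ℝ) - 1 := by
    intro U M
    have := pmOddCutSlack_le_card_sub_one (row U) M
    have hc : ((row U).1.card : ℝ) = t := by rw [hrow]; exact_mod_cast U.2
    linarith
  -- blockwise rescaling of the `t`-row submatrix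
  have hblock : ∀ i : Fin m, ∀ (M : PMatch n) (U : {U : Finset (Fin n) // U.card = t}),
      (A M i * B (row U) i).trace ≤ (t : ℝ) - 1 := by
    intro i M U
    calc (A M i * B (row U) i).trace ≤ ∑ j, (A M j * B (row U) j).trace :=
          single_le_sum (f := fun j => (A M j * B (row U) j).trace)
            (fun j _ => frob_nonneg_of_posSemidef (hA M j) (hB (row U) j)) (mem_univ i)
      _ = pmOddCutSlack n (row U) M := (hS (row U) M).symm
      _ ≤ (t : ℝ) - 1 := hSΔ U M
  have hresc := fun i : Fin m =>
    exists_rescale_opBound b hΔ (fun M : PMatch n => A M i)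
      (fun U : {U : Finset (Fin n) // U.card = t} => B (row U) i)
      (fun M => hA M i) (fun U => hB (row U) i) (fun M U => hblock i M U)
  choose A' B' hA' hB' htr hA'le hB'le using hresc
  -- spectral split of every rescaled block
  have hsplitA := fun (M : PMatch n) (i : Fin m) =>
    exists_sum_vecMulVec_of_posSemidef (hA' i M) (hA'le i M)
  have hsplitB := fun (U : {U : Finset (Fin n) // U.card = t}) (i : Fin m) =>
    exists_sum_vecMulVec_of_posSemidef (hB' i U) (hB'le i U)
  choose a haeq hale using hsplitA
  choose c hceq hcle using hsplitB
  have hid : ∀ (U : {U : Finset (Fin n) // U.card = t}) (M : PMatch n),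
      (((M.1.filter fun f => cutCount U.1 f = 1).card : ℝ) - 1) =
        ∑ i, ∑ s, ∑ s', (a M i s ⬝ᵥ c U i s') ^ 2 := by
    intro U M
    rw [hslack U M, hS (row U) M]
    refine sum_congr rfl fun i _ => ?_
    rw [← htr i M U, haeq M i, hceq U i, Finset.sum_mul, trace_sum]
    refine sum_congr rfl fun s _ => ?_
    rw [Finset.mul_sum, trace_sum]
    exact sum_congr rfl fun s' _ => trace_vecMulVec_mul_vecMulVec _ _
  refine ⟨a, c, hid, fun M i s => hale M i s, fun U i s' => hcle U i s', fun U M h1 i s s' => ?_⟩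
  have h0 : ∑ i, ∑ s, ∑ s', (a M i s ⬝ᵥ c U i s') ^ 2 = 0 := by
    rw [← hid U M, h1]
    norm_num
  have h2 : ∑ s, ∑ s', (a M i s ⬝ᵥ c U i s') ^ 2 = 0 :=
    (sum_eq_zero_iff_of_nonneg fun i _ => sum_nonneg fun s _ => sum_nonneg fun s' _ => sq_nonneg _).1
      h0 i (mem_univ i)
  have h3 : ∑ s', (a M i s ⬝ᵥ c U i s') ^ 2 = 0 :=
    (sum_eq_zero_iff_of_nonneg fun s _ => sum_nonneg fun s' _ => sq_nonneg _).1 h2 s (mem_univ s)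
  have h4 : (a M i s ⬝ᵥ c U i s') ^ 2 = 0 :=
    (sum_eq_zero_iff_of_nonneg fun s' _ => sq_nonneg _).1 h3 s' (mem_univ s')
  exact pow_eq_zero_iff two_ne_zero |>.1 h4

end TCut

/-! ## §6. `(S^b_+)^m`-lifts of `P_PM(n)` give block psd factorizations -/

section Lift

variable {n : ℕ}

/-- `P_PM(n)` is bounded (a convex hull of finitely many `0/1` vectors). [cite: Rothvoss2017, §1 (PDF p. 4)] -/
theorem isBounded_pmPolytope (n : ℕ) : Bornology.IsBounded (pmPolytope n) := by
  refine isBounded_convexHull.2 (((Set.finite_range fun M : Finset (Sym2 (Fin n)) => charVec M).subset ?_).isBounded)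
  rintro x ⟨M, -, rfl⟩
  exact ⟨M, rfl⟩

/-- **An `(S^b_+)^m`-lift of the perfect matching polytope gives a block psd factorization of its odd-cut slack
matrix** (`b, m ≥ 1`): the direction "lift ⇒ factorization" of the cone-factorization theorem
(`HasBlockPsdLift.hasPsdPowerFactorization_slack`; `P_PM(n)` is bounded, no Slater point needed) applied to the
points `χ^M` (perfect matchings `M`) and the valid odd-set inequalities `x(δ(U)) ≥ 1` (`|U|` odd), whose slacks are
`|δ(U) ∩ M| − 1`. This is the dictionary "`P_PM(n)` has an `(S^b_+)^m`-lift ⇒ `HasBlockPsdFactorization n b m`" of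
this file's docstring. [cite: FawziParrilo2013, Thm. 2 (§2.1, p. 6) and §1.2 (p. 5)]
[cite: GouveiaParriloThomas2013, Def. 2.2, Thm. 2.4 (§2)] -/
theorem hasBlockPsdFactorization_of_hasBlockPsdLift {b m : ℕ} (hb : 1 ≤ b) (hm : 1 ≤ m)
    (h : HasBlockPsdLift (pmPolytope n) b m) : HasBlockPsdFactorization n b m := by
  classical
  have hpts : ∀ M : PMatch n, charVec M.1 ∈ pmPolytope n := fun M => charVec_mem_pmPolytope M.2
  have hval : ∀ y ∈ pmPolytope n, ∀ U : OddSet n, oddCutVec U.1 ⬝ᵥ y ≤ (-1 : ℝ) :=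
    fun y hy U => oddCutVec_le U.1 U.2 y hy
  have hfac : FixedSizePsdRank.HasPsdPowerFactorization
      (fun (M : PMatch n) (U : OddSet n) => (-1 : ℝ) - oddCutVec U.1 ⬝ᵥ charVec M.1) b m :=
    HasBlockPsdLift.hasPsdPowerFactorization_slack (x := fun M : PMatch n => charVec M.1)
      (a := fun U : OddSet n => oddCutVec U.1) (b := fun _ => (-1 : ℝ)) hb hm h (isBounded_pmPolytope n)
      hpts hval
  obtain ⟨A, B, hA, hB, hS⟩ := hfac
  refine hasBlockPsdFactorization_iff.2 ⟨A, B, hA, hB, fun U M => ?_⟩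
  have e := hS M U
  change (-1 : ℝ) - oddCutVec U.1 ⬝ᵥ charVec M.1 = _ at e
  rw [← e, pmOddCutSlack_eq_pmSlack, pmSlack, oddCut_slack U.1 M.2]

/-- Hence an `(S^b_+)^m`-lift of `P_PM(n)` is also an ordinary psd factorization of size `b·m` of the odd-cut
slack matrix, so psd-rank lower bounds for `pmOddCutSlack n` bound `b·m`. [cite: FawziParrilo2013, §1.1 (p. 3)] -/
theorem HasBlockPsdLift.hasPsdFactorization_pmOddCutSlack {b m : ℕ} (hb : 1 ≤ b) (hm : 1 ≤ m)
    (h : HasBlockPsdLift (pmPolytope n) b m) : HasPsdFactorization (pmOddCutSlack n) (b * m) :=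
  (hasBlockPsdFactorization_of_hasBlockPsdLift hb hm h).hasPsdFactorization_pmOddCutSlack

end Lift

end Literature.Combinatorics.Optimization

end
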